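import Summits.QuantumFields.YangMills.Theorems.BalabanUVNodesN06StateProducerG0AtPinsPU

/-!
# U8 STEP 3 — the STATE ASSEMBLY at the pins: the four `hstate` tuples of the S-leaves out of the five state-layer faces

Informal companion: `Summits/QuantumFields/YangMills/informal/balaban_uv_nodes.md` §N06, director-ym №272 (5) (the U8 cure: ONE re-leaf edition of rows 20–21 on the S-leaves
`B9Thm312WholeLeafCompletePairMBZSL(R)` ∕ `B9Thm313WholeLeafCompletePairMBCZcUS`, dropping the displayed raw Δ⁽²⁾ letters), №285 (R-b).

WHAT THIS FILE DOES (pure bookkeeping, no new estimate).  The S-leaves of rows 20 (Theorem 3.12) and 21 (Theorem 3.13) display, per member `x` and configuration `U`, two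
«state tuples» over the REGULAR STATE CLASSES `𝔖₂(x,U) := weightNorm (bXH x U) (rwt (−1))` and `𝔖₁(x,U) := bXH x U` (the smooth Hölder class of the G₀-outputs and its
(Lʲη)⁻¹-weighted twin): the perturbation step `StepS` ((3.130)∕(3.138)), the one-step pairs `∇_UG₀T`, `∇_{U,ν}G₀T`, `Φ_βY∇_UG₀T`, `Φ_βX∇_{U,ν}G₀T`, `Φ_βXG₀T` for BOTH
T ∈ {Δ′_π, Δ′_π + Δ⁽²⁾_π}, the producers `G₀`, `G₀∇*_U`, `G₀Q*`, `G₀∇_U`, `G₀∇*_{U,μ}` INTO the classes, the readings `id : 𝔖 → 𝔠^{(−2)} ∕ 𝔠^{(−1)}`, the size `κ ≤ κ_S` and the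
ℓ¹-domination `loc ≤ Λ·Σ|F|`.  The five faces of this seat's U8 state layer deliver exactly these, member-uniformly above thresholds, with THEIR OWN constants and rates:
`…N06StatePairsAtPinsPU.hStatePairs_of_pinsP_geo9Y` (steps + pairs; rate ρ on 𝔖₂, ρ − τ and an extra factor L = ℓ+1 on 𝔖₁), `…N06StateProducerG0AtPinsPU.hG0S2_of_pinsP_geo9Y`
(G₀ : 𝔠⁽⁰⁾ → 𝔖₂), `…N06StateClassFactsAtPinsPU.hStateFacts_of_pinsP_geo9Y` (G₀∇_U : 𝔠_W⁽¹⁾ → 𝔖₂, the two readings, κ, Λ), `…N06StateProducersAAtPinsPU.hProducersA_of_pinsP_geo9Y`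
(G₀∇*_U, G₀Q* twice, G₀∇_U out of the Hölder class) and `…N06StateProducersBAtPinsPU.hProducersB_of_pinsP_geo9Y` (G₀∇*_{U,μ} out of `bHXA ε`, G₀∇_U out of `bHX ε`).
THIS FILE re-rates and re-constants them into the leaves' uniform letters: ONE step∕pair rate `δK` (≤ ρ − τ ≤ ρ), ONE producer∕reading rate `δP` (≤ every face rate), ONE
step constant `θS`, ONE pair constant `θD` and ONE Hölder family `θH β` dominating the faces' constants (the 𝔖₁ members carry the factor `(geo9Y x).L = ℓ+1`, `geo9Y_L`),
by `hasMaj_weaken` (kernel monotonicity, [4] p.232) — and assembles the four tuples in the leaves' displayed order: `hst20` (row 20 on 𝔖₂), `hst10` (row 20 on 𝔖₁), `hst21`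
(row 21 on 𝔖₂), `hst11` (row 21 on 𝔖₁).  The face hypotheses are stated with LETTER constants (`CS₂ CS₁ CD CY CXd CX A₀ AW CR κB AD AQ1 AQ AWH AI AV` and rates
`ρ₂ ρ₁ rG rF rA rB`) in the faces' exact shapes, so the edition passes the faces' outputs with the letters named.

HONEST LABEL: helper, count-neutral; kernel bookkeeping over hypothesis schemas of printed species; N06 NOT discharged; nothing continuum ∕ OS ∕ mass gap ∕ Clay.
[cite: Balaban1985BackgroundPropagators, (3.130)–(3.131) pp.421–422, (3.137)–(3.138) p.423, (3.42)–(3.47) pp.397–398, Thm 3.3 p.399; Balaban1984PropagatorsII, (2.51)–(2.54) pp.232–233, Lemma 2.1 (2.60) p.234]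
-/

noncomputable section

namespace Summit.QuantumFields.YangMills.BalabanUVNodes.N06StateAssemblyAtPinsPU

open Literature.MathematicalPhysics.QuantumFieldTheory.Balaban1983to89
open Literature.MathematicalPhysics.QuantumFieldTheory.Balaban1983to89.Node00 (FBondY IBondY)
open B9Thm34Ext (toB6)
open B11SectG (HasMaj BlockNorm)
open B9Thm312Whole (cNorm GeoOK)
open B9Thm312WholeClasses (cNormR rwt rwt_nonneg)
open B9CoReadingCoords (XBK)
open B9CoReadingCoordsS (XSK)
open B9CoReadingCoordsH (XHK)
open B9CoReadingCoordsTranspose (TrIdx)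
open B9PinMembersKLevelV1 (MemberY geo9Y)
open B9BackgroundsKLevelV1R (RegFamY bg9YR)
open B9GeoLemma21KLevelV1 (geo9Y_len_pos geo9Y_dist_triangle geo9Y_dist_comm)
open B9GeoNormsKLevelV1 (geo9K_dist_nonneg)
open B7Prop2SpecialUnitary (specialUnitaryUnits)
open B9PerturbationMajorantAlgebra (hasMaj_weaken)
open B9SectDSup (weightNorm)
open B9Thm312WholeStepRegular (StepS)
open B9RWSums343Holder (HolderProbes)
open B9Ineq347Reading (geo9Y_L)
open scoped Matrix.Norms.L2Operator

variable {N : ℕ} {d ℓ : ℕ} {hd : 1 ≤ d + 1} {hL : Odd (ℓ + 1) ∧ 1 < ℓ + 1} {b₀ b₁ : ℝ} {Mstar : ℕ}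

/-- Kernel bookkeeping with an extra factor: `C·(Mα₀)·L ≤ θ·(Mα₀)` from `C·(ℓ+1) ≤ θ` and `L = ℓ+1`. [folklore] -/
private theorem mulL_le (x : MemberY d ℓ hd hL b₀ b₁ Mstar) {C θ m : ℝ} (hm : 0 ≤ m) (h : C * (((ℓ + 1 : ℕ) : ℝ)) ≤ θ) :
    C * m * (geo9Y x).L ≤ θ * m := by
  rw [geo9Y_L x, mul_right_comm]; exact mul_le_mul_of_nonneg_right h hm

/-- ★★★ **THE STATE ASSEMBLY AT THE PINS** (module docstring): out of the five state-layer faces (hypotheses `hPairs hG0 hSF hPA hPB`, in the faces' exact shapes with letter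
constants∕rates) and the domination∕ordering of the letters (`θS ≥ CS₂, CS₁`; `θD ≥ CD, CD·(ℓ+1)`; `θH β ≥ CY β, CXd β, CXd β·(ℓ+1), CX β·(ℓ+1)`; `δK ≤ ρ₁ ≤ ρ₂`;
`δP ≤ rG, rF, rA, rB`; `κB ≤ κS`; thresholds `MT∙ ≤ M₁`, `a₁ ≤ a∙`), the four state tuples of the S-leaves, member-uniformly for `M₁ ≤ M`, `Mα₀ ≤ a₁`, U ∈ (3.35)–(3.36):
`hst20 ∧ hst10 ∧ hst21 ∧ hst11` (rows 20∕21 on 𝔖₂∕𝔖₁, in the displayed binder shapes of `thm312Printed_completePairMBZSL_rates` ∕ `thm313Printed_completePairMBCZcUS` at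
`𝔖₂ := weightNorm (bXH x U) (rwt (−1))`, `𝔖₁ := bXH x U`, input norms `bHXA x ε` (K-blocks) and `bHX x ε` (S-blocks)).
[cite: Balaban1985BackgroundPropagators, (3.130)–(3.131) pp.421–422, (3.138) p.423, (3.42)–(3.47) pp.397–398; Balaban1984PropagatorsII, (2.51)–(2.54) pp.232–233, (2.60) p.234] -/
theorem hStateAssembly_of_faces [∀ x : MemberY d ℓ hd hL b₀ b₁ Mstar, Fintype (geo9Y x).Site]
    {R₁ R₂ : RegFamY d ℓ hd hL b₀ b₁ Mstar (Matrix (Fin N) (Fin N) ℂ)} (H : MemberY d ℓ hd hL b₀ b₁ Mstar → Prop) (c : ℝ)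
    (bXH : ∀ x : MemberY d ℓ hd hL b₀ b₁ Mstar, (bg9YR (Matrix (Fin N) (Fin N) ℂ) (specialUnitaryUnits (Fin N)) R₁ R₂ x).Cfg → BlockNorm (toB6 (geo9Y x) 1 (H x)) (XBK (TrIdx N) x.toKIdx → ℝ))
    (bH13 : ∀ x : MemberY d ℓ hd hL b₀ b₁ Mstar, (bg9YR (Matrix (Fin N) (Fin N) ℂ) (specialUnitaryUnits (Fin N)) R₁ R₂ x).Cfg → BlockNorm (toB6 (geo9Y x) 1 (H x)) (XSK (TrIdx N) x.toKIdx → ℝ))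
    (bHXA : ∀ x : MemberY d ℓ hd hL b₀ b₁ Mstar, ℝ → BlockNorm (toB6 (geo9Y x) 1 (H x)) (XBK (TrIdx N) x.toKIdx → ℝ))
    (bHX : ∀ x : MemberY d ℓ hd hL b₀ b₁ Mstar, ℝ → BlockNorm (toB6 (geo9Y x) 1 (H x)) (XSK (TrIdx N) x.toKIdx → ℝ))
    (𝔬12 : ∀ x : MemberY d ℓ hd hL b₀ b₁ Mstar, B9Thm312Whole.Ops (geo9Y x) (bg9YR (Matrix (Fin N) (Fin N) ℂ) (specialUnitaryUnits (Fin N)) R₁ R₂ x) (XBK (TrIdx N) x.toKIdx) (XBK (TrIdx N) x.toKIdx) (XHK (TrIdx N) x.toKIdx) (XSK (TrIdx N) x.toKIdx))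
    {PX PY : MemberY d ℓ hd hL b₀ b₁ Mstar → Type} [∀ x, Fintype (PX x)] [∀ x, Fintype (PY x)]
    (𝔭A : ∀ x : MemberY d ℓ hd hL b₀ b₁ Mstar, HolderProbes (geo9Y x) (bg9YR (Matrix (Fin N) (Fin N) ℂ) (specialUnitaryUnits (Fin N)) R₁ R₂ x) (XBK (TrIdx N) x.toKIdx) (XBK (TrIdx N) x.toKIdx) (PX x) (PY x))
    (Dd Dsd : ∀ x : MemberY d ℓ hd hL b₀ b₁ Mstar, (bg9YR (Matrix (Fin N) (Fin N) ℂ) (specialUnitaryUnits (Fin N)) R₁ R₂ x).Cfg → Fin (d + 1) → Module.End ℝ (XBK (TrIdx N) x.toKIdx → ℝ))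
    (wZ : ∀ x : MemberY d ℓ hd hL b₀ b₁ Mstar, (geo9Y x).Site → ℝ) (hwZ : ∀ (x : MemberY d ℓ hd hL b₀ b₁ Mstar) (y : (geo9Y x).Site), 0 < wZ x y)
    -- the faces' letters (constants ∕ rates ∕ thresholds) and the leaves' letters
    {MTP aP MTG aG MTF aF MTA aA MTB aB M₁ a₁ : ℝ} {CS₂ CS₁ CD ρ₂ ρ₁ A₀ rG AW CR κB rF AD AQ1 AQ AWH rA rB : ℝ} {CY CXd CX AI AV : ℝ → ℝ}
    {θS θD δK δP κS : ℝ} {θH : ℝ → ℝ}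
    (hM₁ : 0 ≤ M₁) (hMP : MTP ≤ M₁) (hMG : MTG ≤ M₁) (hMF : MTF ≤ M₁) (hMA : MTA ≤ M₁) (hMB : MTB ≤ M₁)
    (haP : a₁ ≤ aP) (haG : a₁ ≤ aG) (haF : a₁ ≤ aF) (haA : a₁ ≤ aA) (haB : a₁ ≤ aB)
    (hCS₂ : 0 ≤ CS₂) (hCS₁ : 0 ≤ CS₁) (hCD : 0 ≤ CD) (hCY : ∀ β, 0 ≤ β → β < 1 → 0 ≤ CY β) (hCXd : ∀ β, 0 ≤ β → β < 1 → 0 ≤ CXd β) (hCX : ∀ β, 0 ≤ β → β < 1 → 0 ≤ CX β)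
    (hA₀ : 0 ≤ A₀) (hAW : 0 ≤ AW) (hCR : 0 ≤ CR) (hAD : 0 ≤ AD) (hAQ1 : 0 ≤ AQ1) (hAQ : 0 ≤ AQ) (hAI : ∀ ε, 0 < ε → 0 ≤ AI ε) (hAV : ∀ ε, 0 < ε → 0 ≤ AV ε)
    (hθS₂ : CS₂ ≤ θS) (hθS₁ : CS₁ ≤ θS) (hθD₂ : CD ≤ θD) (hθD₁ : CD * (((ℓ + 1 : ℕ) : ℝ)) ≤ θD)
    (hθHY : ∀ β, 0 ≤ β → β < 1 → CY β ≤ θH β) (hθHXd : ∀ β, 0 ≤ β → β < 1 → CXd β ≤ θH β) (hθHXd₁ : ∀ β, 0 ≤ β → β < 1 → CXd β * (((ℓ + 1 : ℕ) : ℝ)) ≤ θH β)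
    (hθHX₁ : ∀ β, 0 ≤ β → β < 1 → CX β * (((ℓ + 1 : ℕ) : ℝ)) ≤ θH β)
    (hδK₂ : δK ≤ ρ₂) (hδK₁ : δK ≤ ρ₁) (hδPG : δP ≤ rG) (hδPF : δP ≤ rF) (hδPA : δP ≤ rA) (hδPB : δP ≤ rB) (hκS : κB ≤ κS)
    -- the five faces
    (hPairs : ∀ x : MemberY d ℓ hd hL b₀ b₁ Mstar, MTP ≤ (geo9Y x).M → ∀ α₀ : ℝ, 0 < α₀ → (geo9Y x).M * α₀ ≤ aP → ∀ U : (bg9YR (Matrix (Fin N) (Fin N) ℂ) (specialUnitaryUnits (Fin N)) R₁ R₂ x).Cfg, (bg9YR (Matrix (Fin N) (Fin N) ℂ) (specialUnitaryUnits (Fin N)) R₁ R₂ x).Reg335 c α₀ U →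
      (bg9YR (Matrix (Fin N) (Fin N) ℂ) (specialUnitaryUnits (Fin N)) R₁ R₂ x).Reg336 c α₀ U →
        StepS (𝔬12 x) (weightNorm (bXH x U) (rwt (geo9Y x) (-1)) (rwt_nonneg (fun y => (geo9Y_len_pos x y).le) (-1))) (CS₂ * ((geo9Y x).M * α₀)) ρ₂ U ∧
        StepS (𝔬12 x) (bXH x U) (CS₁ * ((geo9Y x).M * α₀)) ρ₁ U ∧
        (HasMaj (weightNorm (bXH x U) (rwt (geo9Y x) (-1)) (rwt_nonneg (fun y => (geo9Y_len_pos x y).le) (-1))) (cNorm 1 (H x) (𝔬12 x).blkY (fun y => (geo9Y_len_pos x y).le) 1) ((𝔬12 x).D U ∘ₗ (𝔬12 x).G0 U ∘ₗ (𝔬12 x).Tpi U) (fun a b => CD * ((geo9Y x).M * α₀) * Real.exp (-(ρ₂ * (geo9Y x).dist a b))) ∧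
          HasMaj (weightNorm (bXH x U) (rwt (geo9Y x) (-1)) (rwt_nonneg (fun y => (geo9Y_len_pos x y).le) (-1))) (cNorm 1 (H x) (𝔬12 x).blkY (fun y => (geo9Y_len_pos x y).le) 1) ((𝔬12 x).D U ∘ₗ (𝔬12 x).G0 U ∘ₗ ((𝔬12 x).Tpi U + (𝔬12 x).T2 U)) (fun a b => CD * ((geo9Y x).M * α₀) * Real.exp (-(ρ₂ * (geo9Y x).dist a b)))) ∧
        (∀ ν : Fin (d + 1),
          (HasMaj (weightNorm (bXH x U) (rwt (geo9Y x) (-1)) (rwt_nonneg (fun y => (geo9Y_len_pos x y).le) (-1))) (cNorm 1 (H x) (𝔬12 x).blk (fun y => (geo9Y_len_pos x y).le) 1) (Dd x U ν ∘ₗ (𝔬12 x).G0 U ∘ₗ (𝔬12 x).Tpi U) (fun a b => CD * ((geo9Y x).M * α₀) * Real.exp (-(ρ₂ * (geo9Y x).dist a b))) ∧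
            HasMaj (weightNorm (bXH x U) (rwt (geo9Y x) (-1)) (rwt_nonneg (fun y => (geo9Y_len_pos x y).le) (-1))) (cNorm 1 (H x) (𝔬12 x).blk (fun y => (geo9Y_len_pos x y).le) 1) (Dd x U ν ∘ₗ (𝔬12 x).G0 U ∘ₗ ((𝔬12 x).Tpi U + (𝔬12 x).T2 U)) (fun a b => CD * ((geo9Y x).M * α₀) * Real.exp (-(ρ₂ * (geo9Y x).dist a b)))) ∧
          (HasMaj (bXH x U) (cNormR 1 (H x) (𝔬12 x).blk (fun y => (geo9Y_len_pos x y).le) 0) (Dd x U ν ∘ₗ (𝔬12 x).G0 U ∘ₗ (𝔬12 x).Tpi U) (fun a b => CD * ((geo9Y x).M * α₀) * (geo9Y x).L * Real.exp (-(ρ₁ * (geo9Y x).dist a b))) ∧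
            HasMaj (bXH x U) (cNormR 1 (H x) (𝔬12 x).blk (fun y => (geo9Y_len_pos x y).le) 0) (Dd x U ν ∘ₗ (𝔬12 x).G0 U ∘ₗ ((𝔬12 x).Tpi U + (𝔬12 x).T2 U)) (fun a b => CD * ((geo9Y x).M * α₀) * (geo9Y x).L * Real.exp (-(ρ₁ * (geo9Y x).dist a b))))) ∧
        (∀ β : ℝ, 0 ≤ β → β < 1 →
          HasMaj (weightNorm (bXH x U) (rwt (geo9Y x) (-1)) (rwt_nonneg (fun y => (geo9Y_len_pos x y).le) (-1))) (cNormR 1 (H x) (𝔭A x).blkPY (fun y => (geo9Y_len_pos x y).le) (β - 1)) (((𝔭A x).ΦY U β ∘ₗ (𝔬12 x).D U ∘ₗ (𝔬12 x).G0 U) ∘ₗ (𝔬12 x).Tpi U) (fun a b => CY β * ((geo9Y x).M * α₀) * Real.exp (-(ρ₂ * (geo9Y x).dist a b))) ∧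
          HasMaj (weightNorm (bXH x U) (rwt (geo9Y x) (-1)) (rwt_nonneg (fun y => (geo9Y_len_pos x y).le) (-1))) (cNormR 1 (H x) (𝔭A x).blkPY (fun y => (geo9Y_len_pos x y).le) (β - 1)) (((𝔭A x).ΦY U β ∘ₗ (𝔬12 x).D U ∘ₗ (𝔬12 x).G0 U) ∘ₗ ((𝔬12 x).Tpi U + (𝔬12 x).T2 U)) (fun a b => CY β * ((geo9Y x).M * α₀) * Real.exp (-(ρ₂ * (geo9Y x).dist a b)))) ∧
        (∀ (ν : Fin (d + 1)) (β : ℝ), 0 ≤ β → β < 1 →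
          (HasMaj (weightNorm (bXH x U) (rwt (geo9Y x) (-1)) (rwt_nonneg (fun y => (geo9Y_len_pos x y).le) (-1))) (cNormR 1 (H x) (𝔭A x).blkPX (fun y => (geo9Y_len_pos x y).le) (β - 1)) (((𝔭A x).ΦX U β ∘ₗ Dd x U ν ∘ₗ (𝔬12 x).G0 U) ∘ₗ (𝔬12 x).Tpi U) (fun a b => CXd β * ((geo9Y x).M * α₀) * Real.exp (-(ρ₂ * (geo9Y x).dist a b))) ∧
            HasMaj (weightNorm (bXH x U) (rwt (geo9Y x) (-1)) (rwt_nonneg (fun y => (geo9Y_len_pos x y).le) (-1))) (cNormR 1 (H x) (𝔭A x).blkPX (fun y => (geo9Y_len_pos x y).le) (β - 1)) (((𝔭A x).ΦX U β ∘ₗ Dd x U ν ∘ₗ (𝔬12 x).G0 U) ∘ₗ ((𝔬12 x).Tpi U + (𝔬12 x).T2 U)) (fun a b => CXd β * ((geo9Y x).M * α₀) * Real.exp (-(ρ₂ * (geo9Y x).dist a b)))) ∧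
          (HasMaj (bXH x U) (cNormR 1 (H x) (𝔭A x).blkPX (fun y => (geo9Y_len_pos x y).le) β) (((𝔭A x).ΦX U β ∘ₗ Dd x U ν ∘ₗ (𝔬12 x).G0 U) ∘ₗ (𝔬12 x).Tpi U) (fun a b => CXd β * ((geo9Y x).M * α₀) * (geo9Y x).L * Real.exp (-(ρ₁ * (geo9Y x).dist a b))) ∧
            HasMaj (bXH x U) (cNormR 1 (H x) (𝔭A x).blkPX (fun y => (geo9Y_len_pos x y).le) β) (((𝔭A x).ΦX U β ∘ₗ Dd x U ν ∘ₗ (𝔬12 x).G0 U) ∘ₗ ((𝔬12 x).Tpi U + (𝔬12 x).T2 U)) (fun a b => CXd β * ((geo9Y x).M * α₀) * (geo9Y x).L * Real.exp (-(ρ₁ * (geo9Y x).dist a b))))) ∧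
        (∀ β : ℝ, 0 ≤ β → β < 1 →
          (HasMaj (weightNorm (bXH x U) (rwt (geo9Y x) (-1)) (rwt_nonneg (fun y => (geo9Y_len_pos x y).le) (-1))) (cNormR 1 (H x) (𝔭A x).blkPX (fun y => (geo9Y_len_pos x y).le) (β - 2)) (((𝔭A x).ΦX U β ∘ₗ (𝔬12 x).G0 U) ∘ₗ (𝔬12 x).Tpi U) (fun a b => CX β * ((geo9Y x).M * α₀) * Real.exp (-(ρ₂ * (geo9Y x).dist a b))) ∧
            HasMaj (weightNorm (bXH x U) (rwt (geo9Y x) (-1)) (rwt_nonneg (fun y => (geo9Y_len_pos x y).le) (-1))) (cNormR 1 (H x) (𝔭A x).blkPX (fun y => (geo9Y_len_pos x y).le) (β - 2)) (((𝔭A x).ΦX U β ∘ₗ (𝔬12 x).G0 U) ∘ₗ ((𝔬12 x).Tpi U + (𝔬12 x).T2 U)) (fun a b => CX β * ((geo9Y x).M * α₀) * Real.exp (-(ρ₂ * (geo9Y x).dist a b)))) ∧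
          (HasMaj (bXH x U) (cNormR 1 (H x) (𝔭A x).blkPX (fun y => (geo9Y_len_pos x y).le) (β - 1)) (((𝔭A x).ΦX U β ∘ₗ (𝔬12 x).G0 U) ∘ₗ (𝔬12 x).Tpi U) (fun a b => CX β * ((geo9Y x).M * α₀) * (geo9Y x).L * Real.exp (-(ρ₁ * (geo9Y x).dist a b))) ∧
            HasMaj (bXH x U) (cNormR 1 (H x) (𝔭A x).blkPX (fun y => (geo9Y_len_pos x y).le) (β - 1)) (((𝔭A x).ΦX U β ∘ₗ (𝔬12 x).G0 U) ∘ₗ ((𝔬12 x).Tpi U + (𝔬12 x).T2 U)) (fun a b => CX β * ((geo9Y x).M * α₀) * (geo9Y x).L * Real.exp (-(ρ₁ * (geo9Y x).dist a b))))))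
    (hG0 : ∀ x : MemberY d ℓ hd hL b₀ b₁ Mstar, MTG ≤ (geo9Y x).M → ∀ α₀ : ℝ, 0 < α₀ → (geo9Y x).M * α₀ ≤ aG → ∀ U : (bg9YR (Matrix (Fin N) (Fin N) ℂ) (specialUnitaryUnits (Fin N)) R₁ R₂ x).Cfg, (bg9YR (Matrix (Fin N) (Fin N) ℂ) (specialUnitaryUnits (Fin N)) R₁ R₂ x).Reg335 c α₀ U →
      (bg9YR (Matrix (Fin N) (Fin N) ℂ) (specialUnitaryUnits (Fin N)) R₁ R₂ x).Reg336 c α₀ U →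
        HasMaj (cNorm 1 (H x) (𝔬12 x).blk (fun y => (geo9Y_len_pos x y).le) 0) (weightNorm (bXH x U) (rwt (geo9Y x) (-1)) (rwt_nonneg (fun y => (geo9Y_len_pos x y).le) (-1))) ((𝔬12 x).G0 U) (fun a b => A₀ * Real.exp (-(rG * (geo9Y x).dist a b))))
    (hSF : ∀ x : MemberY d ℓ hd hL b₀ b₁ Mstar, MTF ≤ (geo9Y x).M → ∀ α₀ : ℝ, 0 < α₀ → (geo9Y x).M * α₀ ≤ aF → ∀ U : (bg9YR (Matrix (Fin N) (Fin N) ℂ) (specialUnitaryUnits (Fin N)) R₁ R₂ x).Cfg, (bg9YR (Matrix (Fin N) (Fin N) ℂ) (specialUnitaryUnits (Fin N)) R₁ R₂ x).Reg335 c α₀ U →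
      (bg9YR (Matrix (Fin N) (Fin N) ℂ) (specialUnitaryUnits (Fin N)) R₁ R₂ x).Reg336 c α₀ U →
        HasMaj (cNorm 1 (H x) (𝔬12 x).blkW (fun y => (geo9Y_len_pos x y).le) 1) (weightNorm (bXH x U) (rwt (geo9Y x) (-1)) (rwt_nonneg (fun y => (geo9Y_len_pos x y).le) (-1))) ((𝔬12 x).G0 U ∘ₗ (𝔬12 x).Dv U) (fun a b => AW * Real.exp (-(rF * (geo9Y x).dist a b))) ∧
        HasMaj (weightNorm (bXH x U) (rwt (geo9Y x) (-1)) (rwt_nonneg (fun y => (geo9Y_len_pos x y).le) (-1))) (cNormR 1 (H x) (𝔬12 x).blk (fun y => (geo9Y_len_pos x y).le) (-2)) LinearMap.id (fun a b => CR * Real.exp (-(rF * (geo9Y x).dist a b))) ∧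
        HasMaj (bXH x U) (cNormR 1 (H x) (𝔬12 x).blk (fun y => (geo9Y_len_pos x y).le) (-1)) LinearMap.id (fun a b => CR * Real.exp (-(rF * (geo9Y x).dist a b))) ∧
        (weightNorm (bXH x U) (rwt (geo9Y x) (-1)) (rwt_nonneg (fun y => (geo9Y_len_pos x y).le) (-1))).κ ≤ κB ∧ (bXH x U).κ ≤ κB ∧
        (∃ Λ : ℝ, 0 ≤ Λ ∧ ∀ (y : (geo9Y x).Site) (F : XBK (TrIdx N) x.toKIdx → ℝ), (weightNorm (bXH x U) (rwt (geo9Y x) (-1)) (rwt_nonneg (fun y => (geo9Y_len_pos x y).le) (-1))).loc y F ≤ Λ * ∑ q : XBK (TrIdx N) x.toKIdx, |F q|) ∧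
        (∃ Λ : ℝ, 0 ≤ Λ ∧ ∀ (y : (geo9Y x).Site) (F : XBK (TrIdx N) x.toKIdx → ℝ), (bXH x U).loc y F ≤ Λ * ∑ q : XBK (TrIdx N) x.toKIdx, |F q|))
    (hPA : ∀ x : MemberY d ℓ hd hL b₀ b₁ Mstar, MTA ≤ (geo9Y x).M → ∀ α₀ : ℝ, 0 < α₀ → (geo9Y x).M * α₀ ≤ aA → ∀ U : (bg9YR (Matrix (Fin N) (Fin N) ℂ) (specialUnitaryUnits (Fin N)) R₁ R₂ x).Cfg, (bg9YR (Matrix (Fin N) (Fin N) ℂ) (specialUnitaryUnits (Fin N)) R₁ R₂ x).Reg335 c α₀ U →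
      (bg9YR (Matrix (Fin N) (Fin N) ℂ) (specialUnitaryUnits (Fin N)) R₁ R₂ x).Reg336 c α₀ U →
        HasMaj (cNormR 1 (H x) (𝔬12 x).blkY (fun y => (geo9Y_len_pos x y).le) 0) (bXH x U) ((𝔬12 x).G0 U ∘ₗ (𝔬12 x).Dstar U) (fun a b => AD * Real.exp (-(rA * (geo9Y x).dist a b))) ∧
        HasMaj (weightNorm (BlockNorm.ofBlocks (toB6 (geo9Y x) 1 (H x)) (𝔬12 x).blkZ) (fun y => (geo9Y x).len y * wZ x y) (fun y => (mul_pos (geo9Y_len_pos x y) (hwZ x y)).le)) (bXH x U) ((𝔬12 x).G0 U ∘ₗ (𝔬12 x).Qstar U) (fun a b => AQ1 * Real.exp (-(rA * (geo9Y x).dist a b))) ∧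
        HasMaj (weightNorm (BlockNorm.ofBlocks (toB6 (geo9Y x) 1 (H x)) (𝔬12 x).blkZ) (wZ x) (fun y => (hwZ x y).le)) (weightNorm (bXH x U) (rwt (geo9Y x) (-1)) (rwt_nonneg (fun y => (geo9Y_len_pos x y).le) (-1))) ((𝔬12 x).G0 U ∘ₗ (𝔬12 x).Qstar U) (fun a b => AQ * Real.exp (-(rA * (geo9Y x).dist a b))) ∧
        HasMaj (bH13 x U) (weightNorm (bXH x U) (rwt (geo9Y x) (-1)) (rwt_nonneg (fun y => (geo9Y_len_pos x y).le) (-1))) ((𝔬12 x).G0 U ∘ₗ (𝔬12 x).Dv U) (fun a b => AWH * Real.exp (-(rA * (geo9Y x).dist a b))))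
    (hPB : ∀ x : MemberY d ℓ hd hL b₀ b₁ Mstar, MTB ≤ (geo9Y x).M → ∀ α₀ : ℝ, 0 < α₀ → (geo9Y x).M * α₀ ≤ aB → ∀ U : (bg9YR (Matrix (Fin N) (Fin N) ℂ) (specialUnitaryUnits (Fin N)) R₁ R₂ x).Cfg, (bg9YR (Matrix (Fin N) (Fin N) ℂ) (specialUnitaryUnits (Fin N)) R₁ R₂ x).Reg335 c α₀ U →
      (bg9YR (Matrix (Fin N) (Fin N) ℂ) (specialUnitaryUnits (Fin N)) R₁ R₂ x).Reg336 c α₀ U →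
        (∀ (μ : Fin (d + 1)) (ε : ℝ), 0 < ε → HasMaj (bHXA x ε) (bXH x U) ((𝔬12 x).G0 U ∘ₗ Dsd x U μ) (fun a b => AI ε * Real.exp (-(rB * (geo9Y x).dist a b)))) ∧
        (∀ ε : ℝ, 0 < ε → HasMaj (bHX x ε) (bXH x U) ((𝔬12 x).G0 U ∘ₗ (𝔬12 x).Dv U) (fun a b => AV ε * Real.exp (-(rB * (geo9Y x).dist a b))))) :
    ∀ x : MemberY d ℓ hd hL b₀ b₁ Mstar, M₁ ≤ (geo9Y x).M → ∀ α₀ : ℝ, 0 < α₀ → (geo9Y x).M * α₀ ≤ a₁ → ∀ U : (bg9YR (Matrix (Fin N) (Fin N) ℂ) (specialUnitaryUnits (Fin N)) R₁ R₂ x).Cfg, (bg9YR (Matrix (Fin N) (Fin N) ℂ) (specialUnitaryUnits (Fin N)) R₁ R₂ x).Reg335 c α₀ U →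
      (bg9YR (Matrix (Fin N) (Fin N) ℂ) (specialUnitaryUnits (Fin N)) R₁ R₂ x).Reg336 c α₀ U →
        (StepS (𝔬12 x) (weightNorm (bXH x U) (rwt (geo9Y x) (-1)) (rwt_nonneg (fun y => (geo9Y_len_pos x y).le) (-1))) (θS * ((geo9Y x).M * α₀)) δK U ∧
          (HasMaj (weightNorm (bXH x U) (rwt (geo9Y x) (-1)) (rwt_nonneg (fun y => (geo9Y_len_pos x y).le) (-1))) (cNorm 1 (H x) (𝔬12 x).blkY (fun y => (geo9Y_len_pos x y).le) 1) ((𝔬12 x).D U ∘ₗ (𝔬12 x).G0 U ∘ₗ (𝔬12 x).Tpi U) (fun a b => θD * ((geo9Y x).M * α₀) * Real.exp (-(δK * (geo9Y x).dist a b))) ∧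
            HasMaj (weightNorm (bXH x U) (rwt (geo9Y x) (-1)) (rwt_nonneg (fun y => (geo9Y_len_pos x y).le) (-1))) (cNorm 1 (H x) (𝔬12 x).blkY (fun y => (geo9Y_len_pos x y).le) 1) ((𝔬12 x).D U ∘ₗ (𝔬12 x).G0 U ∘ₗ ((𝔬12 x).Tpi U + (𝔬12 x).T2 U)) (fun a b => θD * ((geo9Y x).M * α₀) * Real.exp (-(δK * (geo9Y x).dist a b)))) ∧
          (∀ β : ℝ, 0 ≤ β → β < 1 →
            HasMaj (weightNorm (bXH x U) (rwt (geo9Y x) (-1)) (rwt_nonneg (fun y => (geo9Y_len_pos x y).le) (-1))) (cNormR 1 (H x) (𝔭A x).blkPY (fun y => (geo9Y_len_pos x y).le) (β - 1)) (((𝔭A x).ΦY U β ∘ₗ (𝔬12 x).D U ∘ₗ (𝔬12 x).G0 U) ∘ₗ (𝔬12 x).Tpi U) (fun a b => θH β * ((geo9Y x).M * α₀) * Real.exp (-(δK * (geo9Y x).dist a b))) ∧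
            HasMaj (weightNorm (bXH x U) (rwt (geo9Y x) (-1)) (rwt_nonneg (fun y => (geo9Y_len_pos x y).le) (-1))) (cNormR 1 (H x) (𝔭A x).blkPY (fun y => (geo9Y_len_pos x y).le) (β - 1)) (((𝔭A x).ΦY U β ∘ₗ (𝔬12 x).D U ∘ₗ (𝔬12 x).G0 U) ∘ₗ ((𝔬12 x).Tpi U + (𝔬12 x).T2 U)) (fun a b => θH β * ((geo9Y x).M * α₀) * Real.exp (-(δK * (geo9Y x).dist a b)))) ∧
          HasMaj (cNorm 1 (H x) (𝔬12 x).blk (fun y => (geo9Y_len_pos x y).le) 0) (weightNorm (bXH x U) (rwt (geo9Y x) (-1)) (rwt_nonneg (fun y => (geo9Y_len_pos x y).le) (-1))) ((𝔬12 x).G0 U) (fun a b => A₀ * Real.exp (-(δP * (geo9Y x).dist a b))) ∧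
          HasMaj (weightNorm (BlockNorm.ofBlocks (toB6 (geo9Y x) 1 (H x)) (𝔬12 x).blkZ) (wZ x) (fun y => (hwZ x y).le)) (weightNorm (bXH x U) (rwt (geo9Y x) (-1)) (rwt_nonneg (fun y => (geo9Y_len_pos x y).le) (-1))) ((𝔬12 x).G0 U ∘ₗ (𝔬12 x).Qstar U) (fun a b => AQ * Real.exp (-(δP * (geo9Y x).dist a b))) ∧
          HasMaj (weightNorm (bXH x U) (rwt (geo9Y x) (-1)) (rwt_nonneg (fun y => (geo9Y_len_pos x y).le) (-1))) (cNormR 1 (H x) (𝔬12 x).blk (fun y => (geo9Y_len_pos x y).le) (-2)) LinearMap.id (fun a b => CR * Real.exp (-(δP * (geo9Y x).dist a b))) ∧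
          (weightNorm (bXH x U) (rwt (geo9Y x) (-1)) (rwt_nonneg (fun y => (geo9Y_len_pos x y).le) (-1))).κ ≤ κS ∧
          (∃ Λ : ℝ, 0 ≤ Λ ∧ ∀ (y : (geo9Y x).Site) (F : XBK (TrIdx N) x.toKIdx → ℝ), (weightNorm (bXH x U) (rwt (geo9Y x) (-1)) (rwt_nonneg (fun y => (geo9Y_len_pos x y).le) (-1))).loc y F ≤ Λ * ∑ q : XBK (TrIdx N) x.toKIdx, |F q|)) ∧
        (StepS (𝔬12 x) (bXH x U) (θS * ((geo9Y x).M * α₀)) δK U ∧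
          (∀ ν : Fin (d + 1),
            HasMaj (bXH x U) (cNormR 1 (H x) (𝔬12 x).blk (fun y => (geo9Y_len_pos x y).le) 0) (Dd x U ν ∘ₗ (𝔬12 x).G0 U ∘ₗ (𝔬12 x).Tpi U) (fun a b => θD * ((geo9Y x).M * α₀) * Real.exp (-(δK * (geo9Y x).dist a b))) ∧
            HasMaj (bXH x U) (cNormR 1 (H x) (𝔬12 x).blk (fun y => (geo9Y_len_pos x y).le) 0) (Dd x U ν ∘ₗ (𝔬12 x).G0 U ∘ₗ ((𝔬12 x).Tpi U + (𝔬12 x).T2 U)) (fun a b => θD * ((geo9Y x).M * α₀) * Real.exp (-(δK * (geo9Y x).dist a b)))) ∧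
          (∀ β : ℝ, 0 ≤ β → β < 1 →
            HasMaj (bXH x U) (cNormR 1 (H x) (𝔭A x).blkPX (fun y => (geo9Y_len_pos x y).le) (β - 1)) (((𝔭A x).ΦX U β ∘ₗ (𝔬12 x).G0 U) ∘ₗ (𝔬12 x).Tpi U) (fun a b => θH β * ((geo9Y x).M * α₀) * Real.exp (-(δK * (geo9Y x).dist a b))) ∧
            HasMaj (bXH x U) (cNormR 1 (H x) (𝔭A x).blkPX (fun y => (geo9Y_len_pos x y).le) (β - 1)) (((𝔭A x).ΦX U β ∘ₗ (𝔬12 x).G0 U) ∘ₗ ((𝔬12 x).Tpi U + (𝔬12 x).T2 U)) (fun a b => θH β * ((geo9Y x).M * α₀) * Real.exp (-(δK * (geo9Y x).dist a b)))) ∧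
          (∀ (ν : Fin (d + 1)) (β : ℝ), 0 ≤ β → β < 1 →
            HasMaj (bXH x U) (cNormR 1 (H x) (𝔭A x).blkPX (fun y => (geo9Y_len_pos x y).le) β) (((𝔭A x).ΦX U β ∘ₗ Dd x U ν ∘ₗ (𝔬12 x).G0 U) ∘ₗ (𝔬12 x).Tpi U) (fun a b => θH β * ((geo9Y x).M * α₀) * Real.exp (-(δK * (geo9Y x).dist a b))) ∧
            HasMaj (bXH x U) (cNormR 1 (H x) (𝔭A x).blkPX (fun y => (geo9Y_len_pos x y).le) β) (((𝔭A x).ΦX U β ∘ₗ Dd x U ν ∘ₗ (𝔬12 x).G0 U) ∘ₗ ((𝔬12 x).Tpi U + (𝔬12 x).T2 U)) (fun a b => θH β * ((geo9Y x).M * α₀) * Real.exp (-(δK * (geo9Y x).dist a b)))) ∧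
          HasMaj (cNormR 1 (H x) (𝔬12 x).blkY (fun y => (geo9Y_len_pos x y).le) 0) (bXH x U) ((𝔬12 x).G0 U ∘ₗ (𝔬12 x).Dstar U) (fun a b => AD * Real.exp (-(δP * (geo9Y x).dist a b))) ∧
          (∀ (μ : Fin (d + 1)) (ε : ℝ), 0 < ε → HasMaj (bHXA x ε) (bXH x U) ((𝔬12 x).G0 U ∘ₗ Dsd x U μ) (fun a b => AI ε * Real.exp (-(δP * (geo9Y x).dist a b)))) ∧
          HasMaj (bXH x U) (cNormR 1 (H x) (𝔬12 x).blk (fun y => (geo9Y_len_pos x y).le) (-1)) LinearMap.id (fun a b => CR * Real.exp (-(δP * (geo9Y x).dist a b))) ∧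
          (bXH x U).κ ≤ κS ∧
          (∃ Λ : ℝ, 0 ≤ Λ ∧ ∀ (y : (geo9Y x).Site) (F : XBK (TrIdx N) x.toKIdx → ℝ), (bXH x U).loc y F ≤ Λ * ∑ q : XBK (TrIdx N) x.toKIdx, |F q|)) ∧
        (StepS (𝔬12 x) (weightNorm (bXH x U) (rwt (geo9Y x) (-1)) (rwt_nonneg (fun y => (geo9Y_len_pos x y).le) (-1))) (θS * ((geo9Y x).M * α₀)) δK U ∧
          HasMaj (weightNorm (bXH x U) (rwt (geo9Y x) (-1)) (rwt_nonneg (fun y => (geo9Y_len_pos x y).le) (-1))) (cNorm 1 (H x) (𝔬12 x).blkY (fun y => (geo9Y_len_pos x y).le) 1) ((𝔬12 x).D U ∘ₗ (𝔬12 x).G0 U ∘ₗ ((𝔬12 x).Tpi U + (𝔬12 x).T2 U)) (fun a b => θD * ((geo9Y x).M * α₀) * Real.exp (-(δK * (geo9Y x).dist a b))) ∧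
          (∀ ν : Fin (d + 1), HasMaj (weightNorm (bXH x U) (rwt (geo9Y x) (-1)) (rwt_nonneg (fun y => (geo9Y_len_pos x y).le) (-1))) (cNorm 1 (H x) (𝔬12 x).blk (fun y => (geo9Y_len_pos x y).le) 1) (Dd x U ν ∘ₗ (𝔬12 x).G0 U ∘ₗ ((𝔬12 x).Tpi U + (𝔬12 x).T2 U)) (fun a b => θD * ((geo9Y x).M * α₀) * Real.exp (-(δK * (geo9Y x).dist a b)))) ∧
          (∀ β : ℝ, 0 ≤ β → β < 1 → HasMaj (weightNorm (bXH x U) (rwt (geo9Y x) (-1)) (rwt_nonneg (fun y => (geo9Y_len_pos x y).le) (-1))) (cNormR 1 (H x) (𝔭A x).blkPY (fun y => (geo9Y_len_pos x y).le) (β - 1)) (((𝔭A x).ΦY U β ∘ₗ (𝔬12 x).D U ∘ₗ (𝔬12 x).G0 U) ∘ₗ ((𝔬12 x).Tpi U + (𝔬12 x).T2 U)) (fun a b => θH β * ((geo9Y x).M * α₀) * Real.exp (-(δK * (geo9Y x).dist a b)))) ∧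
          (∀ (ν : Fin (d + 1)) (β : ℝ), 0 ≤ β → β < 1 → HasMaj (weightNorm (bXH x U) (rwt (geo9Y x) (-1)) (rwt_nonneg (fun y => (geo9Y_len_pos x y).le) (-1))) (cNormR 1 (H x) (𝔭A x).blkPX (fun y => (geo9Y_len_pos x y).le) (β - 1)) (((𝔭A x).ΦX U β ∘ₗ Dd x U ν ∘ₗ (𝔬12 x).G0 U) ∘ₗ ((𝔬12 x).Tpi U + (𝔬12 x).T2 U)) (fun a b => θH β * ((geo9Y x).M * α₀) * Real.exp (-(δK * (geo9Y x).dist a b)))) ∧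
          HasMaj (cNorm 1 (H x) (𝔬12 x).blk (fun y => (geo9Y_len_pos x y).le) 0) (weightNorm (bXH x U) (rwt (geo9Y x) (-1)) (rwt_nonneg (fun y => (geo9Y_len_pos x y).le) (-1))) ((𝔬12 x).G0 U) (fun a b => A₀ * Real.exp (-(δP * (geo9Y x).dist a b))) ∧
          HasMaj (cNorm 1 (H x) (𝔬12 x).blkW (fun y => (geo9Y_len_pos x y).le) 1) (weightNorm (bXH x U) (rwt (geo9Y x) (-1)) (rwt_nonneg (fun y => (geo9Y_len_pos x y).le) (-1))) ((𝔬12 x).G0 U ∘ₗ (𝔬12 x).Dv U) (fun a b => AW * Real.exp (-(δP * (geo9Y x).dist a b))) ∧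
          HasMaj (weightNorm (BlockNorm.ofBlocks (toB6 (geo9Y x) 1 (H x)) (𝔬12 x).blkZ) (wZ x) (fun y => (hwZ x y).le)) (weightNorm (bXH x U) (rwt (geo9Y x) (-1)) (rwt_nonneg (fun y => (geo9Y_len_pos x y).le) (-1))) ((𝔬12 x).G0 U ∘ₗ (𝔬12 x).Qstar U) (fun a b => AQ * Real.exp (-(δP * (geo9Y x).dist a b))) ∧
          HasMaj (weightNorm (bXH x U) (rwt (geo9Y x) (-1)) (rwt_nonneg (fun y => (geo9Y_len_pos x y).le) (-1))) (cNormR 1 (H x) (𝔬12 x).blk (fun y => (geo9Y_len_pos x y).le) (-2)) LinearMap.id (fun a b => CR * Real.exp (-(δP * (geo9Y x).dist a b))) ∧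
          (∃ Λ : ℝ, 0 ≤ Λ ∧ ∀ (y : (geo9Y x).Site) (F : XBK (TrIdx N) x.toKIdx → ℝ), (weightNorm (bXH x U) (rwt (geo9Y x) (-1)) (rwt_nonneg (fun y => (geo9Y_len_pos x y).le) (-1))).loc y F ≤ Λ * ∑ q : XBK (TrIdx N) x.toKIdx, |F q|)) ∧
        (StepS (𝔬12 x) (bXH x U) (θS * ((geo9Y x).M * α₀)) δK U ∧
          (∀ ν : Fin (d + 1), HasMaj (bXH x U) (cNormR 1 (H x) (𝔬12 x).blk (fun y => (geo9Y_len_pos x y).le) 0) (Dd x U ν ∘ₗ (𝔬12 x).G0 U ∘ₗ ((𝔬12 x).Tpi U + (𝔬12 x).T2 U)) (fun a b => θD * ((geo9Y x).M * α₀) * Real.exp (-(δK * (geo9Y x).dist a b)))) ∧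
          (∀ β : ℝ, 0 ≤ β → β < 1 → HasMaj (bXH x U) (cNormR 1 (H x) (𝔭A x).blkPX (fun y => (geo9Y_len_pos x y).le) (β - 1)) (((𝔭A x).ΦX U β ∘ₗ (𝔬12 x).G0 U) ∘ₗ ((𝔬12 x).Tpi U + (𝔬12 x).T2 U)) (fun a b => θH β * ((geo9Y x).M * α₀) * Real.exp (-(δK * (geo9Y x).dist a b)))) ∧
          (∀ (ν : Fin (d + 1)) (β : ℝ), 0 ≤ β → β < 1 → HasMaj (bXH x U) (cNormR 1 (H x) (𝔭A x).blkPX (fun y => (geo9Y_len_pos x y).le) β) (((𝔭A x).ΦX U β ∘ₗ Dd x U ν ∘ₗ (𝔬12 x).G0 U) ∘ₗ ((𝔬12 x).Tpi U + (𝔬12 x).T2 U)) (fun a b => θH β * ((geo9Y x).M * α₀) * Real.exp (-(δK * (geo9Y x).dist a b)))) ∧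
          HasMaj (cNormR 1 (H x) (𝔬12 x).blkY (fun y => (geo9Y_len_pos x y).le) 0) (bXH x U) ((𝔬12 x).G0 U ∘ₗ (𝔬12 x).Dstar U) (fun a b => AD * Real.exp (-(δP * (geo9Y x).dist a b))) ∧
          (∀ (μ : Fin (d + 1)) (ε : ℝ), 0 < ε → HasMaj (bHXA x ε) (bXH x U) ((𝔬12 x).G0 U ∘ₗ Dsd x U μ) (fun a b => AI ε * Real.exp (-(δP * (geo9Y x).dist a b)))) ∧
          (∀ ε : ℝ, 0 < ε → HasMaj (bHX x ε) (bXH x U) ((𝔬12 x).G0 U ∘ₗ (𝔬12 x).Dv U) (fun a b => AV ε * Real.exp (-(δP * (geo9Y x).dist a b)))) ∧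
          HasMaj (weightNorm (BlockNorm.ofBlocks (toB6 (geo9Y x) 1 (H x)) (𝔬12 x).blkZ) (fun y => (geo9Y x).len y * wZ x y) (fun y => (mul_pos (geo9Y_len_pos x y) (hwZ x y)).le)) (bXH x U) ((𝔬12 x).G0 U ∘ₗ (𝔬12 x).Qstar U) (fun a b => AQ1 * Real.exp (-(δP * (geo9Y x).dist a b))) ∧
          HasMaj (bXH x U) (cNormR 1 (H x) (𝔬12 x).blk (fun y => (geo9Y_len_pos x y).le) (-1)) LinearMap.id (fun a b => CR * Real.exp (-(δP * (geo9Y x).dist a b))) ∧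
          (∃ Λ : ℝ, 0 ≤ Λ ∧ ∀ (y : (geo9Y x).Site) (F : XBK (TrIdx N) x.toKIdx → ℝ), (bXH x U).loc y F ≤ Λ * ∑ q : XBK (TrIdx N) x.toKIdx, |F q|)) := by
  intro x hM α₀ hα ha U hU hU'
  have hG : GeoOK (geo9Y x) := ⟨geo9Y_dist_triangle x, geo9Y_dist_comm x, geo9K_dist_nonneg x.toKIdx, geo9Y_len_pos x⟩
  have hMα : 0 ≤ (geo9Y x).M * α₀ := mul_nonneg (hM₁.trans hM) hα.le
  obtain ⟨hS2, hS1, hD2, hDd, hY, hXd, hX⟩ := hPairs x (hMP.trans hM) α₀ hα (ha.trans haP) U hU hU'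
  have hPG := hG0 x (hMG.trans hM) α₀ hα (ha.trans haG) U hU hU'
  obtain ⟨hW, hR2, hR1, hκ2, hκ1, hΛ2, hΛ1⟩ := hSF x (hMF.trans hM) α₀ hα (ha.trans haF) U hU hU'
  obtain ⟨hDs, hQ1, hQ2, -⟩ := hPA x (hMA.trans hM) α₀ hα (ha.trans haA) U hU hU'
  obtain ⟨hI, hV⟩ := hPB x (hMB.trans hM) α₀ hα (ha.trans haB) U hU hU'
  -- weakening abbreviations: constants `C·(Mα₀)` resp. `C·(Mα₀)·L` into `θ·(Mα₀)`, rates into `δK`; producer rates into `δP`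
  have nS := fun {C : ℝ} (hC : 0 ≤ C) => mul_nonneg hC hMα
  have hL0 : (0 : ℝ) ≤ (geo9Y x).L := by rw [geo9Y_L x]; positivity
  have nL := fun {C : ℝ} (hC : 0 ≤ C) => mul_nonneg (mul_nonneg hC hMα) hL0
  have eS := fun {C θ : ℝ} (h : C ≤ θ) => mul_le_mul_of_nonneg_right h hMα
  have eL := fun {C θ : ℝ} (h : C * (((ℓ + 1 : ℕ) : ℝ)) ≤ θ) => mulL_le x hMα h
  -- steps
  have sS2 : StepS (𝔬12 x) (weightNorm (bXH x U) (rwt (geo9Y x) (-1)) (rwt_nonneg (fun y => (geo9Y_len_pos x y).le) (-1))) (θS * ((geo9Y x).M * α₀)) δK U :=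
    ⟨hasMaj_weaken hG (nS hCS₂) (eS hθS₂) hδK₂ hS2.step, hasMaj_weaken hG (nS hCS₂) (eS hθS₂) hδK₂ hS2.step1⟩
  have sS1 : StepS (𝔬12 x) (bXH x U) (θS * ((geo9Y x).M * α₀)) δK U :=
    ⟨hasMaj_weaken hG (nS hCS₁) (eS hθS₁) hδK₁ hS1.step, hasMaj_weaken hG (nS hCS₁) (eS hθS₁) hδK₁ hS1.step1⟩
  -- producers ∕ readings at the common rate δP
  have pG := hasMaj_weaken hG hA₀ le_rfl hδPG hPG
  have pW := hasMaj_weaken hG hAW le_rfl hδPF hW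
  have pR2 := hasMaj_weaken hG hCR le_rfl hδPF hR2
  have pR1 := hasMaj_weaken hG hCR le_rfl hδPF hR1
  have pDs := hasMaj_weaken hG hAD le_rfl hδPA hDs
  have pQ1 := hasMaj_weaken hG hAQ1 le_rfl hδPA hQ1
  have pQ2 := hasMaj_weaken hG hAQ le_rfl hδPA hQ2
  have pI := fun (μ : Fin (d + 1)) (ε : ℝ) (hε : 0 < ε) => hasMaj_weaken hG (hAI ε hε) le_rfl hδPB (hI μ ε hε)
  have pV := fun (ε : ℝ) (hε : 0 < ε) => hasMaj_weaken hG (hAV ε hε) le_rfl hδPB (hV ε hε)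
  refine ⟨⟨sS2, ⟨hasMaj_weaken hG (nS hCD) (eS hθD₂) hδK₂ hD2.1, hasMaj_weaken hG (nS hCD) (eS hθD₂) hδK₂ hD2.2⟩,
      fun β hβ hβ' => ⟨hasMaj_weaken hG (nS (hCY β hβ hβ')) (eS (hθHY β hβ hβ')) hδK₂ (hY β hβ hβ').1,
        hasMaj_weaken hG (nS (hCY β hβ hβ')) (eS (hθHY β hβ hβ')) hδK₂ (hY β hβ hβ').2⟩,
      pG, pQ2, pR2, hκ2.trans hκS, hΛ2⟩,
    ⟨sS1, fun ν => ⟨hasMaj_weaken hG (nL hCD) (eL hθD₁) hδK₁ (hDd ν).2.1, hasMaj_weaken hG (nL hCD) (eL hθD₁) hδK₁ (hDd ν).2.2⟩,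
      fun β hβ hβ' => ⟨hasMaj_weaken hG (nL (hCX β hβ hβ')) (eL (hθHX₁ β hβ hβ')) hδK₁ (hX β hβ hβ').2.1,
        hasMaj_weaken hG (nL (hCX β hβ hβ')) (eL (hθHX₁ β hβ hβ')) hδK₁ (hX β hβ hβ').2.2⟩,
      fun ν β hβ hβ' => ⟨hasMaj_weaken hG (nL (hCXd β hβ hβ')) (eL (hθHXd₁ β hβ hβ')) hδK₁ (hXd ν β hβ hβ').2.1,
        hasMaj_weaken hG (nL (hCXd β hβ hβ')) (eL (hθHXd₁ β hβ hβ')) hδK₁ (hXd ν β hβ hβ').2.2⟩,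
      pDs, pI, pR1, hκ1.trans hκS, hΛ1⟩,
    ⟨sS2, hasMaj_weaken hG (nS hCD) (eS hθD₂) hδK₂ hD2.2, fun ν => hasMaj_weaken hG (nS hCD) (eS hθD₂) hδK₂ (hDd ν).1.2,
      fun β hβ hβ' => hasMaj_weaken hG (nS (hCY β hβ hβ')) (eS (hθHY β hβ hβ')) hδK₂ (hY β hβ hβ').2,
      fun ν β hβ hβ' => hasMaj_weaken hG (nS (hCXd β hβ hβ')) (eS (hθHXd β hβ hβ')) hδK₂ (hXd ν β hβ hβ').1.2,
      pG, pW, pQ2, pR2, hΛ2⟩,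
    ⟨sS1, fun ν => hasMaj_weaken hG (nL hCD) (eL hθD₁) hδK₁ (hDd ν).2.2,
      fun β hβ hβ' => hasMaj_weaken hG (nL (hCX β hβ hβ')) (eL (hθHX₁ β hβ hβ')) hδK₁ (hX β hβ hβ').2.2,
      fun ν β hβ hβ' => hasMaj_weaken hG (nL (hCXd β hβ hβ')) (eL (hθHXd₁ β hβ hβ')) hδK₁ (hXd ν β hβ hβ').2.2,
      pDs, pI, pV, pQ1, pR1, hΛ1⟩⟩

end Summit.QuantumFields.YangMills.BalabanUVNodes.N06StateAssemblyAtPinsPU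

end
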